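import Summits.ResolutionOfSingularities.ResolutionOfSingularities.Theorems.HomologicalConductorNoZenoExcDegreeNonzero
import Summits.ResolutionOfSingularities.ResolutionOfSingularities.Theorems.HomologicalConductorNoZenoCarriedPrincipal
import Summits.ResolutionOfSingularities.ResolutionOfSingularities.Theorems.HomologicalConductorNoZenoLemmaLDischarged
import Literature.AlgebraicGeometry.Resolution.ExceptionalCurveDegree
import Literature.AlgebraicGeometry.Resolution.ExceptionalCurvePoints
import Literature.AlgebraicGeometry.Resolution.PrimeDivisorIdeals
import Literature.AlgebraicGeometry.Motives.CartierDivisorEffectiveOfOrdAt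
import Literature.AlgebraicGeometry.Motives.CartierDivisorSameDivisorOfOrdAt
import Literature.AlgebraicGeometry.Motives.CartierDivisorExcess
import Literature.AlgebraicGeometry.Motives.CurveSignedFamilies
import Literature.AlgebraicGeometry.Motives.CartierDivisorOfIdealSheaf
import HarnessLib

/-!
# Crux `NoZenoR` (stmt-ResolutionOfSingularities-19943), facts slot: `(E_η²) ≤ 0` FACT-FREE
# (the sign half of Lipman's Lemma (14.1) at a single integral exceptional curve)

Route `ResolutionOfSingularities/HomologicalConductor` (cell decomp-res, hand leafhand-res-homologicalconduct-7 g0).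
OURS: AI-written, weaker than expert review; nothing here is a statement of the manuscript under review (Hironaka 2017).
Def-free, FACT-FREE (no named fact is consumed).

For a desingularization `π : X → Spec S` of a two-dimensional normal Noetherian local domain and an integral exceptional
curve `E_η` (`η ∈ excCurvePoints π`, `[E_η] = ofIsEffectiveCartier 𝓘_η`): **`(E_η · E_η) ≤ 0`**.  Proof (the classical
one, Mumford / Lipman §14 p. 224, for ONE curve): take `0 ≠ f ∈ 𝔪_S`; the principal divisor `P = div(π^* f)` is effective,
has `(P · E_η) = 0` (tree `excCurveDegree_principal`) and order `a = ord_η(P) ≥ 1` along `E_η` (`f ∈ 𝔪 = π(η)`); with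
`e = ord_η([E_η]) ≥ 1`, the divisor `D' = e·P − a·[E_η]` has order `0` at `η` and order `e·ord_z(P) ≥ 0` at every other
codimension-one point (those lie off `E_η`), so on the regular `X` it is EFFECTIVE and AVOIDS `η`
(`isEffective_of_forall_ordAt_nonneg`, `IsEffective.avoids_of_ordAt_eq_zero`), whence `(D' · E_η) ≥ 0`
(`excCurveDegree_nonneg_of_isEffective`); and `e·P` and `D' + a·[E_η]` have the same orders everywhere, so define the same
divisor (`sameDivisor_of_forall_ordAt_eq`): `0 = e·(P·E_η) = (D'·E_η) + a·(E_η·E_η) ≥ a·(E_η²)`, i.e. `(E_η²) ≤ 0`.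

* `excCurveDegree_self_nonpos` — the statement (universe `0`, the instance of every consumer).

The STRICT inequality `(E_η²) < 0` (Lemma (14.1) at a singleton; typed fact `Lipman1969_14_1`) needs in addition that `D'`
actually MEETS `E_η` (connectedness of the exceptional fibre + a strict transform through it) and is NOT proved here.
-/

noncomputable section

-- single-problem summit: the doubled namespace component `ResolutionOfSingularities` is forced
set_option linter.dupNamespace false

namespace Summit.ResolutionOfSingularities.ResolutionOfSingularities.Theorems.NoZeno.ExcCount

open CategoryTheory AlgebraicGeometry TopologicalSpace IsLocalRing Order
open Literature.AlgebraicGeometry.Resolution Literature.AlgebraicGeometry.Motives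
open Literature.AlgebraicGeometry.Motives.RatFn

/-- **`(E_η · E_η) ≤ 0` for every integral exceptional curve of a desingularization of a two-dimensional normal
Noetherian local domain** (fact-free; the sign half of Lipman's Lemma (14.1) for one curve): with `0 ≠ f ∈ 𝔪_S`,
`P = div(π^*f) ≥ 0`, `a = ord_η P ≥ 1`, `e = ord_η [E_η] ≥ 1`, the divisor `e·P − a·[E_η]` is effective and avoids `η`,
so `0 = e·(P·E_η) = ((e·P − a·[E_η])·E_η) + a·(E_η²) ≥ a·(E_η²)`.
[cite: Lipman1969, Lemma (14.1) (p. 224)] -/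
theorem excCurveDegree_self_nonpos {S : Type} [CommRing S] [IsNoetherianRing S] [IsLocalRing S] [IsDomain S]
    [IsIntegrallyClosed S] (h2 : ringKrullDim S = 2) {X : Scheme.{0}} {π : X ⟶ Spec (.of S)} [IsIntegral X]
    [IsLocallyNoetherian X] (hπ : IsResolution π) {η : X} (hη : η ∈ excCurvePoints π)
    (hc : IsEffectiveCartier (primeDivisorIdeal η)) :
    excCurveDegree π (CartierDivisor.ofIsEffectiveCartier (primeDivisorIdeal η) hc) η ≤ 0 := by
  classical
  haveI : IsProper π := hπ.isProper
  have hX : Scheme.IsRegular X := hπ.isRegular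
  -- a non-zero element of the maximal ideal (`S` is not a field: `dim S = 2`)
  have hm : maximalIdeal S ≠ ⊥ := by
    intro h
    have h0 := ringKrullDim_eq_zero_of_isField (IsLocalRing.isField_iff_maximalIdeal_eq.mpr h)
    rw [h2] at h0
    exact absurd h0 (by decide)
  obtain ⟨f, hfm, hf0⟩ := Submodule.exists_mem_ne_zero_of_ne_bot hm
  -- the principal divisor `P = div(π^* f)`: effective, of positive order along `E_η`, degree `0` on `E_η`
  have hφ0 : baseToFunctionField π f ≠ 0 := fun h =>
    hf0 (NoZeno.SandwichCluster.LemmaL.baseToFunctionField_injective π hπ (by rw [h, map_zero]))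
  set P : CartierDivisor X := CartierDivisor.principal (baseToFunctionField π f) hφ0 with hPdef
  have hPeff : P.IsEffective := fun _ y _ => NoZeno.SandwichCluster.isRegularAt_baseToFunctionField π y f
  have hcoη : coheight η = 1 := hπ.coheight_eq_one_of_mem_excCurvePoints h2 hη
  have hPη : ¬ IsUnitAt η (P.f PUnit.unit) := by
    change ¬ IsUnitAt η (baseToFunctionField π f)
    rw [isUnitAt_baseToFunctionField_iff, not_not, hη.1]
    exact hfm
  have ha : 0 < P.ordAt η := hPeff.ordAt_pos (i := PUnit.unit) trivial hPη hcoη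
  -- the prime divisor `E = [E_η]`: effective, positive order at `η`, order `0` at every other codimension-one point
  set E : CartierDivisor X := CartierDivisor.ofIsEffectiveCartier (primeDivisorIdeal η) hc with hEdef
  have hEeff : E.IsEffective := CartierDivisor.isEffective_ofIsEffectiveCartier _ hc
  have hEav : ∀ z : X, ¬ η ⤳ z → E.Avoids z := fun z hz =>
    (CartierDivisor.avoids_ofIsEffectiveCartier_iff _ hc z).2 (by rwa [mem_support_primeDivisorIdeal_iff])
  have hEη : ¬ E.Avoids η := fun h =>
    (CartierDivisor.avoids_ofIsEffectiveCartier_iff _ hc η).1 h ((mem_support_primeDivisorIdeal_iff η η).2 le_rfl)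
  have he : 0 < E.ordAt η := by
    simp only [CartierDivisor.Avoids, not_forall] at hEη
    obtain ⟨i, hi, hu⟩ := hEη
    exact hEeff.ordAt_pos hi hu hcoη
  -- codimension-one points other than `η` lie off `E_η`
  have hoff : ∀ z : X, coheight z = 1 → z ≠ η → E.ordAt z = 0 := by
    intro z hz hzη
    refine (hEav z fun hsp => ?_).ordAt_eq_zero
    -- `z` a proper specialisation of `η` would have coheight `≥ 2`
    have hlt : z < η := ⟨Scheme.le_iff_specializes.2 hsp,
      fun h' => hzη ((Scheme.le_iff_specializes.1 h').antisymm hsp).eq⟩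
    have h1 := Order.coheight_add_one_le hlt
    rw [hcoη, hz] at h1
    exact absurd h1 (by decide)
  -- `D' = e·P − a·E`
  set aN : ℕ := (P.ordAt η).toNat with haN
  set eN : ℕ := (E.ordAt η).toNat with heN
  have haZ : (aN : ℤ) = P.ordAt η := Int.toNat_of_nonneg ha.le
  have heZ : (eN : ℤ) = E.ordAt η := Int.toNat_of_nonneg he.le
  set D' : CartierDivisor X := eN • P + -(aN • E) with hD'def
  have hD'ord : ∀ z : X, D'.ordAt z = eN * P.ordAt z - aN * E.ordAt z := by
    intro z
    rw [hD'def, CartierDivisor.ordAt_add, CartierDivisor.ordAt_neg, CartierDivisor.ordAt_smul,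
      CartierDivisor.ordAt_smul]
    ring
  have hD'η : D'.ordAt η = 0 := by
    rw [hD'ord, ← haZ, ← heZ]; ring
  have hD'eff : D'.IsEffective := by
    refine CartierDivisor.isEffective_of_forall_ordAt_nonneg hX fun z hz => ?_
    by_cases hzη : z = η
    · rw [hzη, hD'η]
    · rw [hD'ord, hoff z hz hzη, mul_zero, sub_zero]
      exact mul_nonneg (Nat.cast_nonneg _) (hPeff.ordAt_nonneg z)
  have hD'av : D'.Avoids η := hD'eff.avoids_of_ordAt_eq_zero hcoη hD'η
  have hD'deg : 0 ≤ excCurveDegree π D' η := excCurveDegree_nonneg_of_isEffective π hη hD'eff hD'av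
  -- `e·P` and `D' + a·E` define the same divisor
  have hsame : (eN • P).SameDivisor (D' + aN • E) :=
    CartierDivisor.sameDivisor_of_forall_ordAt_eq hX fun z _ => by
      rw [CartierDivisor.ordAt_add, hD'ord, CartierDivisor.ordAt_smul, CartierDivisor.ordAt_smul]
      ring
  have hdeg : (eN : ℤ) * excCurveDegree π P η = excCurveDegree π D' η + aN * excCurveDegree π E η := by
    rw [← excCurveDegree_smul π hη, excCurveDegree_congr_linEquiv π hη hsame.linEquiv,
      excCurveDegree_add π hη, excCurveDegree_smul π hη]
  rw [hPdef, excCurveDegree_principal π hη hφ0, mul_zero] at hdeg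
  -- `0 = (D'·E_η) + a·(E_η²)` with `(D'·E_η) ≥ 0`, `a ≥ 1`
  have haN0 : 0 < (aN : ℤ) := by rw [haZ]; exact ha
  by_contra hpos
  have := mul_pos haN0 (not_le.mp hpos)
  linarith

end Summit.ResolutionOfSingularities.ResolutionOfSingularities.Theorems.NoZeno.ExcCount

end
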